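import Literature.AnabelianGeometry.SemiGraphs.TemperedSpecialFibreTowerPiData
import Literature.AnabelianGeometry.SemiGraphs.TemperedReconstruction
import HarnessLib

/-!
# The special-fibre tower's Π-action IS an action on the semi-graph OF ANABELIOIDS `𝒢^c` — ORIGIN DATUM (P2′)
# `SpecialFibreTower.PiData.ActGraphInduces` ([IUTchI] §2 p. 47; [SemiAnbd] Ex. 3.10 p. 44) — successor of `PiData`, policy D

Mochizuki, *Inter-universal Teichmüller theory I*, §2 p. 47 l. 22–24 ("suppose … that the sub-semi-graph `ℍ ⊆ 𝔾` is
stabilized by the natural action of `G_k` on `𝔾`" — `𝔾` being the SEMI-GRAPH OF ANABELIOIDS of p. 44), Cor. 2.3 (i) p. 47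
("the natural outer actions of `G_k` on `Δ^tp_X` … determine natural outer actions of `G_k` on `Δ^tp_{X,ℍ}`")
[cite: Mochizuki2012, IUTchI Cor 2.3(i) p.47] [claim: Mochizuki2012, status: disputed]; Mochizuki, *Semi-graphs of
anabelioids*, Publ. RIMS **42** (2006), Ex. 3.10 p. 44 l. 14 ("semi-graphs of anabelioids `𝒢_i`, `𝒢^c_i` on which `Δ_i`
acts"), Prop. 3.6 (iv) p. 39 (a morphism of semi-graphs of anabelioids induces, via `B^temp`, an outer homomorphism of
tempered fundamental groups) [cite: MochizukiSemiAnbd2006, Ex 3.10 p.44].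

abc-iut cell, seat abc-iut-w4-d052 gen 6; GAP-LEDGER G-w4d052-g6-1 part (P4-ii); L3-lead rulings γ32 / γ38 (way (a):
ORIGIN-DATA successor, POLICY D, successor style — abc-iut-L3-t2's landed `TemperedSpecialFibreTowerPiData.lean` is NOT
edited), L5-lead RULINGS #104/#105 (census class DATUM-INTERNAL (P2′)).

WHY A SUCCESSOR DATUM.  The record `SpecialFibreTower.PiData` pins the action of `Π = Π^tp_X` on the special fibre ONLY on
the UNDERLYING SEMI-GRAPH (`actGraph₀ : Π →* Aut 𝔾^c`, its vertex part forced by [SemiAnbd] Thm. 3.7 (iv),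
`actGraph₀_vertexMap`; `H_stable`).  It records no link between the conjugation automorphisms `autOfConj g` of
`π₁^temp(𝒢^c)` and automorphisms of the semi-graph OF ANABELIOIDS `𝒢^c`.  NEGATIVE KNOWLEDGE OF RECORD (L3-lead γ32 (2)):
the group-level law `hHstab` of [IUTchI] Cor. 2.3 ("the `Π`-conjugacy class of a decomposition group `Π^tp_ℍ` is stable")
is NOT derivable from those fields for a multi-vertex `ℍ` — witness: `𝔾` = two vertices joined by two closed edges `e₁`,
`e₂`, `ℍ = {v₁, v₂, e₁}`, `θ := π₁^temp` of the automorphism of the semi-graph of anabelioids swapping `e₁ ↔ e₂` (vertices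
fixed): every vertex-level law holds with `actGraph₀ := id` and `ℍ` is trivially stable, yet `θ(Π^tp_ℍ) = Π^tp_{{v₁,v₂,e₂}}`
is not conjugate to `Π^tp_ℍ` (they differ by the stable letter of `e₂`).  The gluing / edge part of the action is exactly
what the record leaves free; in print it is part of the MEANING of "the natural action of `G_k` on `𝔾`" (`G_k` acts on the
stable model's special fibre, hence on `𝒢^c` as a semi-graph of anabelioids, compatibly with `Δ^tp_X ↠ Π^tp_𝔾`).

THIS FILE: the Prop-valued ORIGIN DATUM **`P.ActGraphInduces`** — for every `g ∈ Π`, the conjugation automorphism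
`autOfConj g` of `π₁^temp(𝒢^c)` is INDUCED ([SemiAnbd] Prop. 3.6 (iv), abc-iut-L3-t2's `Hom.Induces`) by a locally trivial
morphism `F_g : 𝒢^c → 𝒢^c` of the semi-graph of anabelioids whose underlying semi-graph automorphism is the record's
`actGraph₀ g` — stated VERBATIM as the hypothesis `hgr` consumed by abc-iut-L5's
`hHstab_of_mem_decompSubgroups_of_graphic` (`TemperedCoveringsCor23OfSpecialFibreDecompGraphic.lean`), so that consumers
display `(hind : P.ActGraphInduces)` and pass it BY `Iff.rfl`; plus two bookkeeping lemmas.  HONEST LIMITS: an origin datum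
is a HYPOTHESIS about THE special-fibre tower of a curve, asserted for no curve; its derivation from [SemiAnbd] Cor. 3.9
(graphicity of the quasi-geometric automorphisms `autOfConj g`) is the BANKED L3 row «COR39-INSTANCE-AUTOFCONJ» (F-1710
instance programme).  No instance, no notation, no `Prop` FACT (a predicate on the record); nothing here bears on
[IUTchIII] Cor. 3.12 or asserts that abc is proved or refuted.
-/

noncomputable section

namespace Literature.AnabelianGeometry.SemiGraphs

namespace SpecialFibreTower

namespace PiData

open CategoryTheory ProfiniteSemiGraph

variable {p : ℕ} [Fact p.Prime] {X : TemperedCurve p} {d : X.GroupLevelData}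
  {S : SpecialFibreData (X.toTemperedArithmeticGroup d)} {T : SpecialFibreTower X.DeltaTemp}

/-- **ORIGIN DATUM (P2′): the `Π`-action on the special fibre is an action on the SEMI-GRAPH OF ANABELIOIDS `𝒢^c`,
compatible with the outer action on `Π^tp_𝔾`** ([IUTchI] p. 47 l. 22–24 "the natural action of `G_k` on `𝔾`";
[SemiAnbd] Ex. 3.10 p. 44 "`𝒢^c_i` on which `Δ_i` acts"; Prop. 3.6 (iv)): for every `g ∈ Π^tp_X` there is a locally
trivial morphism `F_g : 𝒢^c → 𝒢^c` over the record's semi-graph automorphism `actGraph₀ g` which INDUCES, through the chart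
`S.chart` on both sides, the conjugation automorphism `autOfConj g` of `π₁^temp(𝒢^c)` (`Hom.Induces`: `B^temp(autOfConj g)
≅ c⁻¹ ⋙ F_g^* ⋙ c`).  A HYPOTHESIS on the genuine datum (policy D); `IsIso F_g.base` follows from the base equation.
[cite: Mochizuki2012, IUTchI Cor 2.3(i) p.47] -/
def ActGraphInduces (P : PiData X d S T) : Prop :=
  ∀ g : X.PiTemp, ∃ F : ProfiniteSemiGraph.Hom S.Gc S.Gc, F.IsLocallyTrivial ∧
    F.base = (P.actGraph₀ g).hom ∧
    F.Induces S.chart S.chart ⟨S.autHom P.admissibleKer_normal_pi g, S.continuous_autHom P.admissibleKer_normal_pi g⟩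

/-- Unfolding (the consumer's displayed hypothesis `hgr` of `hHstab_of_mem_decompSubgroups_of_graphic` IS this datum).
[cite: Mochizuki2012, IUTchI Cor 2.3(i) p.47] -/
theorem actGraphInduces_iff (P : PiData X d S T) :
    P.ActGraphInduces ↔ ∀ g : X.PiTemp, ∃ F : ProfiniteSemiGraph.Hom S.Gc S.Gc, F.IsLocallyTrivial ∧
      F.base = (P.actGraph₀ g).hom ∧
      F.Induces S.chart S.chart ⟨S.autHom P.admissibleKer_normal_pi g, S.continuous_autHom P.admissibleKer_normal_pi g⟩ :=
  Iff.rfl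

/-- Under the datum, each `F_g` is an ISOMORPHISM on underlying semi-graphs (its base is the record's `actGraph₀ g ∈ Aut 𝔾^c`),
so abc-iut-L3-d6's transport machinery (`Hom.btempPullbackEquiv`) and abc-iut-w4-d052's
`map_mem_decompSubgroups_of_induces` apply to it. [cite: MochizukiSemiAnbd2006, Prop 3.6(iv) p.39] -/
theorem ActGraphInduces.exists_isIso {P : PiData X d S T} (h : P.ActGraphInduces) (g : X.PiTemp) :
    ∃ F : ProfiniteSemiGraph.Hom S.Gc S.Gc, F.IsLocallyTrivial ∧ IsIso (C := SemiGraph) F.base ∧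
      F.base = (P.actGraph₀ g).hom ∧
      F.Induces S.chart S.chart ⟨S.autHom P.admissibleKer_normal_pi g, S.continuous_autHom P.admissibleKer_normal_pi g⟩ := by
  obtain ⟨F, hlt, hbase, hind⟩ := h g
  exact ⟨F, hlt, by rw [hbase]; infer_instance, hbase, hind⟩

/-- The induced homomorphism named in the datum is `autOfConj g` as a bare monoid homomorphism (definitional bookkeeping for
consumers who write `(S.autOfConj _ g).toMulEquiv.toMonoidHom`). [cite: MochizukiSemiAnbd2006, Ex 3.10 p.44] -/
theorem autHom_eq_autOfConj_toMonoidHom (P : PiData X d S T) (g : X.PiTemp) :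
    S.autHom P.admissibleKer_normal_pi g = (S.autOfConj P.admissibleKer_normal_pi g).toMulEquiv.toMonoidHom :=
  rfl

end PiData

end SpecialFibreTower

end Literature.AnabelianGeometry.SemiGraphs

end
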